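import Summits.CriticalPhenomena.CardyFormulaZ2.Theorems.CardyComplexConeSLESixFamiliesGiveCardyCollarDomainsPart5

/-!
# The lower comparison rectangle (helper file 6 for `stub_collarDomains`)

Route `CardyComplexCone`, crux `SLESixFamiliesGiveCardy`, line `collar-touch-sandwich`, STUB E.
The LOWER comparison rectangle `Q = (Ω₂; c⁺, d′, a′, b⁺)` of a collar set-up `S : CollarSetup R ε`:
windows `[m₀ + δ, m₁ - δ]`, `[m₂ + δ, m₃ - δ]` (collars behind shortened `(ab)` and `(cd)`), mark
parameters `(t_c, m₃ - δ, m₀ + 1 + δ, t_b + 1)` for collar marks `t_c ∈ [m₂ + 2δ, m₂ + 3δ]`,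
`t_b ∈ [m₁ - 3δ, m₁ - 2δ]`; `LowerCollarGeom R (Q.chord 0 3) (Q.arc 1)` (`lowerCollarGeom`) and the
closeness clauses (`lower_close`).
-/

noncomputable section

open Set Metric Topology Filter
open Literature.Probability.RandomPlanarGeometry

namespace Summit.CriticalPhenomena.CardyFormulaZ2.Cruxes.SLESixFamiliesGiveCardy.CollarTouchSandwich

namespace CollarSetup

variable {R : ConformalRectangle} {ε : ℝ} (S : CollarSetup R ε)

/-- The windows of the lower rectangle: `[m₀ + δ, m₁ - δ]` and `[m₂ + δ, m₃ - δ]`, ramp `δ`. -/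
def lowerW : Windows where
  m := R.mark 0
  a₁ := R.mark 0 + S.δ
  b₁ := R.mark 1 - S.δ
  a₂ := R.mark 2 + S.δ
  b₂ := R.mark 3 - S.δ
  d := S.δ
  m_lt := by linarith [S.δ_pos]
  a₁_lt := by linarith [S.gap₀, S.δ_pos]
  b₁_lt := by linarith [R.marks_chain.2.2.1, S.δ_pos]
  a₂_lt := by linarith [S.gap₂, S.δ_pos]
  b₂_lt := by linarith [S.δ_pos, R.marks_chain.2.2.2.2]
  d_pos := S.δ_pos

/-- The windows of the lower rectangle, unfolded. -/
theorem lowerW_eq : S.lowerW.m = R.mark 0 ∧ S.lowerW.a₁ = R.mark 0 + S.δ ∧ S.lowerW.b₁ = R.mark 1 - S.δ ∧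
    S.lowerW.a₂ = R.mark 2 + S.δ ∧ S.lowerW.b₂ = R.mark 3 - S.δ ∧ S.lowerW.d = S.δ := ⟨rfl, rfl, rfl, rfl, rfl, rfl⟩

/-- The profile of the lower rectangle. -/
def lowerP : Profile := S.lowerW.profile S.h_pos S.h_le_half

/-- The collar domain of the lower rectangle. -/
def lowerDomain : JordanDomain := profileDomain S.T S.lowerP

/-- The mark parameters of the lower rectangle for collar marks `t_c`, `t_b` on the plateaus. -/
def lowerM {t_c t_b : ℝ} (htc : t_c ∈ Icc (R.mark 2 + 2 * S.δ) (R.mark 2 + 3 * S.δ))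
    (htb : t_b ∈ Icc (R.mark 1 - 3 * S.δ) (R.mark 1 - 2 * S.δ)) : MarkParams where
  τ := ![t_c, R.mark 3 - S.δ, R.mark 0 + 1 + S.δ, t_b + 1]
  lt₀₁ := by have := S.gap₂; have := S.δ_pos; simp; linarith [htc.2]
  lt₁₂ := by have := R.marks_chain; have := S.δ_pos; simp; linarith
  lt₂₃ := by have := S.gap₀; have := S.δ_pos; simp; linarith [htb.1]
  lt₃₀ := by have := R.marks_chain; have := S.δ_pos; simp; linarith [htb.2, htc.1]

/-- **The lower comparison rectangle** `(Ω₂; c⁺, d′, a′, b⁺)`. -/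
def lowerRect {t_c t_b : ℝ} (htc : t_c ∈ Icc (R.mark 2 + 2 * S.δ) (R.mark 2 + 3 * S.δ))
    (htb : t_b ∈ Icc (R.mark 1 - 3 * S.δ) (R.mark 1 - 2 * S.δ)) : ConformalRectangle :=
  rebase S.lowerDomain (S.lowerM htc htb)

/-- **The lower profile is `1` on `[m₃ - δ, m₀ + 1 + δ]`** (around the arc `(da)`). -/
theorem lowerP_eq_one₃ {t : ℝ} (ht : t ∈ Icc (R.mark 3 - S.δ) (R.mark 0 + 1 + S.δ)) : S.lowerP.p t = 1 := by
  obtain ⟨hm0, hm01, hm12, hm23, hm30⟩ := R.marks_chain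
  have hδ := S.δ_pos; have hδ1 := S.δ_lt; have hg2 := S.gap₂
  obtain ⟨em, ea₁, eb₁, ea₂, eb₂, -⟩ := S.lowerW_eq
  rw [lowerP, S.lowerW.profile_eq_one_iff, ea₁, eb₁, ea₂, eb₂]
  rcases lt_or_ge t (R.mark 0 + 1) with h0 | h0
  · rw [S.lowerW.rep_of_mem ⟨by rw [em]; linarith [ht.1], by rw [em]; exact h0⟩]
    exact ⟨fun h => by linarith [h.2, ht.1], fun h => by linarith [h.2, ht.1]⟩
  · rw [S.lowerW.rep_of_mem_add_one ⟨by rw [em]; exact h0, by rw [em]; linarith [ht.2]⟩]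
    exact ⟨fun h => by linarith [h.1, ht.2], fun h => by linarith [h.1, ht.2]⟩

variable {t_c t_b : ℝ} (htc : t_c ∈ Icc (R.mark 2 + 2 * S.δ) (R.mark 2 + 3 * S.δ))
  (htb : t_b ∈ Icc (R.mark 1 - 3 * S.δ) (R.mark 1 - 2 * S.δ))

/-- The mark parameters of the lower rectangle, unfolded. -/
theorem lowerM_τ : (S.lowerM htc htb).τ 0 = t_c ∧ (S.lowerM htc htb).τ 1 = R.mark 3 - S.δ ∧
    (S.lowerM htc htb).τ 2 = R.mark 0 + 1 + S.δ ∧ (S.lowerM htc htb).τ 3 = t_b + 1 := ⟨rfl, rfl, rfl, rfl⟩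

/-- The carrier of the lower rectangle is the lower collar domain. -/
@[simp] theorem carrier_lowerRect : (S.lowerRect htc htb).carrier = S.lowerDomain.carrier := rfl

/-- The boundary loop of the lower rectangle is the re-based profile loop. -/
theorem boundary_lowerRect (s : ℝ) :
    (S.lowerRect htc htb).boundary s = profileLoop S.T S.lowerP.p (s + t_c) := rfl

/-- The marks of the lower rectangle shifted back by `c = t_c`. -/
theorem mark_lowerRect_add (i : Fin 4) : (S.lowerRect htc htb).mark i + t_c = (S.lowerM htc htb).τ i := by
  rw [lowerRect, mark_rebase_eq]; show _ - t_c + t_c = _; ring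

/-- **The arcs of the lower readout**: wired arc `L[t_c, t_b + 1]`, touch set
`Q.arc 1 = L[m₃ - δ, m₀ + 1 + δ]`, marks `L t_c`, `L (t_b + 1)`. -/
theorem lower_arcs :
    ((S.lowerRect htc htb).chord 0 3 (by decide)).arc 0 = profileLoop S.T S.lowerP.p '' Icc t_c (t_b + 1) ∧
    (S.lowerRect htc htb).arc 1 = profileLoop S.T S.lowerP.p '' Icc (R.mark 3 - S.δ) (R.mark 0 + 1 + S.δ) ∧
    ((S.lowerRect htc htb).chord 0 3 (by decide)).pt 0 = profileLoop S.T S.lowerP.p t_c ∧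
    ((S.lowerRect htc htb).chord 0 3 (by decide)).pt 1 = profileLoop S.T S.lowerP.p (t_b + 1) := by
  obtain ⟨h0, -⟩ := arc_chord03 S.lowerDomain (S.lowerM htc htb)
  obtain ⟨h1, -⟩ := arc_rebase S.lowerDomain (S.lowerM htc htb)
  refine ⟨h0, h1, ?_, ?_⟩
  · rw [MarkedDomain.pt_chord_zero, lowerRect, pt_rebase]; rfl
  · rw [MarkedDomain.pt_chord_one, lowerRect, pt_rebase]; rfl

include htc htb in
/-- The representatives of the collar mark parameters lie in the open windows. -/
theorem lower_rep_marks : S.lowerW.rep t_c ∈ Ioo S.lowerW.a₂ S.lowerW.b₂ ∧ S.lowerW.rep (t_b + 1) ∈ Ioo S.lowerW.a₁ S.lowerW.b₁ := by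
  obtain ⟨hm0, hm01, hm12, hm23, hm30⟩ := R.marks_chain
  have hδ := S.δ_pos; have hg0 := S.gap₀; have hg2 := S.gap₂
  obtain ⟨em, ea₁, eb₁, ea₂, eb₂, -⟩ := S.lowerW_eq
  rw [ea₁, eb₁, ea₂, eb₂, S.lowerW.rep_of_mem ⟨by rw [em]; linarith [htc.1], by rw [em]; linarith [htc.2]⟩,
    S.lowerW.rep_of_mem_add_one ⟨by rw [em]; linarith [htb.1], by rw [em]; linarith [htb.2]⟩, add_sub_cancel_right]
  exact ⟨⟨by linarith [htc.1], by linarith [htc.2]⟩, by linarith [htb.1], by linarith [htb.2]⟩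

include htc htb in
/-- A parameter of the wired arc `[t_c, t_b + 1]` whose loop point lies in `closure Ω` is in
`[m₃ - δ, m₀ + 1 + δ]`. -/
theorem lower_mem_Icc_of_closure {t : ℝ} (ht : t ∈ Icc t_c (t_b + 1))
    (hcl : profileLoop S.T S.lowerP.p t ∈ closure R.carrier) : t ∈ Icc (R.mark 3 - S.δ) (R.mark 0 + 1 + S.δ) := by
  obtain ⟨hm0, hm01, hm12, hm23, hm30⟩ := R.marks_chain
  have hδ := S.δ_pos
  obtain ⟨em, ea₁, eb₁, ea₂, eb₂, -⟩ := S.lowerW_eq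
  obtain ⟨h1, h2⟩ := profile_eq_one_of_mem_closure R S.T S.lowerW S.h_pos S.h_le_half hcl
  rcases lt_or_ge t (R.mark 0 + 1) with h0 | h0
  · rw [S.lowerW.rep_of_mem ⟨by rw [em]; linarith [htc.1, ht.1], by rw [em]; exact h0⟩] at h2
    rw [ea₂, eb₂, mem_Ioo, not_and_or, not_lt, not_lt] at h2
    exact ⟨h2.resolve_left (by intro h; linarith [htc.1, ht.1]), by linarith⟩
  · rw [S.lowerW.rep_of_mem_add_one ⟨by rw [em]; exact h0, by rw [em]; linarith [htb.2, ht.2]⟩] at h1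
    rw [ea₁, eb₁, mem_Ioo, not_and_or, not_lt, not_lt] at h1
    exact ⟨by linarith, by linarith [h1.resolve_right (by intro h; linarith [htb.2, ht.2])]⟩

include htc htb in
/-- **Geometry of the lower readout.** -/
theorem lowerCollarGeom :
    LowerCollarGeom R ((S.lowerRect htc htb).chord 0 3 (by decide)) ((S.lowerRect htc htb).arc 1) := by
  obtain ⟨hm0, hm01, hm12, hm23, hm30⟩ := R.marks_chain
  have hδ := S.δ_pos; have hg0 := S.gap₀; have hg2 := S.gap₂
  obtain ⟨n0, n1, n2, n3⟩ := R.nextMarks_eq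
  obtain ⟨hA0, hG, hp0, hp1⟩ := S.lower_arcs htc htb
  obtain ⟨em, ea₁, eb₁, ea₂, eb₂, -⟩ := S.lowerW_eq
  have hh1 : S.h < 1 := by linarith [S.h_le]
  set L := profileLoop S.T S.lowerP.p with hL
  have hflat₃ : ∀ t ∈ Icc (R.mark 3 - S.δ) (R.mark 0 + 1 + S.δ), L t = R.boundary t := fun t ht =>
    profileLoop_eq_boundary R S.T S.lowerW S.h_pos S.h_le_half (S.lowerP_eq_one₃ ht)
  have harc3 : R.arc 3 = R.boundary '' Icc (R.mark 3) (R.mark 0 + 1) := by rw [MarkedDomain.arc, n3]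
  obtain ⟨rc, rb⟩ := S.lower_rep_marks htc htb
  -- the two collar pieces
  set C₀ := collarPiece R S.T S.h S.lowerW.a₁ S.lowerW.b₁ with hC₀
  set C₂ := collarPiece R S.T S.h S.lowerW.a₂ S.lowerW.b₂ with hC₂
  have hK₀ : IsCompact C₀ := isCompact_collarPiece R S.T hh1 _ _
  have hK₂ : IsCompact C₂ := isCompact_collarPiece R S.T hh1 _ _
  have hsub₀ : Icc S.lowerW.a₁ S.lowerW.b₁ ⊆ Ioo (R.mark 0) (R.nextMark 0) := by
    rw [ea₁, eb₁, n0]; exact fun t ht => ⟨by linarith [ht.1], by linarith [ht.2]⟩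
  have hsub₂ : Icc S.lowerW.a₂ S.lowerW.b₂ ⊆ Ioo (R.mark 2) (R.nextMark 2) := by
    rw [ea₂, eb₂, n2]; exact fun t ht => ⟨by linarith [ht.1], by linarith [ht.2]⟩
  -- points of the collar domain off `Ω` are in the pieces
  have hsplit : ∀ z ∈ S.lowerDomain.carrier, z ∉ R.carrier → z ∈ C₀ ∪ C₂ := fun z hz hzΩ =>
    mem_collarPiece_union R S.T S.lowerW S.h_pos S.h_le_half (subset_closure hz) hzΩ (Or.inl hz)
  -- the marks are in the pieces
  have hpc : L t_c ∈ C₂ := tube_mem_collarPiece R S.T ⟨S.lowerW.one_le_profile _ _ _, S.lowerP.upper _⟩ (n := 0)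
    (by rw [ea₂, eb₂]; push_cast; rw [add_zero]; exact ⟨by linarith [htc.1], by linarith [htc.2]⟩)
  have hpb : L (t_b + 1) ∈ C₀ := tube_mem_collarPiece R S.T ⟨S.lowerW.one_le_profile _ _ _, S.lowerP.upper _⟩ (n := -1)
    (by rw [ea₁, eb₁]; push_cast; rw [add_neg_cancel_right]; exact ⟨by linarith [htb.1], by linarith [htb.2]⟩)
  have hpcΩ : L t_c ∉ closure R.carrier := profileLoop_not_mem_closure R S.T S.lowerW S.h_pos S.h_le_half (Or.inr rc)
  have hpbΩ : L (t_b + 1) ∉ closure R.carrier := profileLoop_not_mem_closure R S.T S.lowerW S.h_pos S.h_le_half (Or.inl rb)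
  refine ⟨?_, ?_, ?_, ?_, ?_⟩
  · exact carrier_subset_profileDomain S.T S.lowerP (S.hclose S.lowerP rfl) (S.lowerW.one_le_profile _ _)
  · rw [hG, harc3]
    rintro _ ⟨t, ht, rfl⟩
    have ht' : t ∈ Icc (R.mark 3 - S.δ) (R.mark 0 + 1 + S.δ) := ⟨by linarith [ht.1], by linarith [ht.2]⟩
    exact ⟨t, ht', hflat₃ t ht'⟩
  · rw [hA0, hG]
    rintro _ ⟨⟨t, ht, rfl⟩, hcl⟩
    exact ⟨t, S.lower_mem_Icc_of_closure htc htb ht hcl, rfl⟩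
  · intro i
    match i with
    | 0 => rw [hp0]; exact hpcΩ
    | 1 => rw [hp1]; exact hpbΩ
  · -- the split
    obtain ⟨r₁, hr₁, hsep⟩ := exists_pos_le_dist hK₀ hK₂ (disjoint_collarPiece R S.T hh1
      (by rw [ea₁]; linarith) (by rw [eb₁, ea₂]; linarith) (by rw [eb₂]; linarith [(R.mark_mem 3).2]))
    have hF₀ne : (R.arc 1 ∪ R.arc 2 ∪ R.arc 3).Nonempty := ⟨_, Or.inr (R.pt_mem_arc_self 3)⟩
    have hF₂ne : (R.arc 0 ∪ R.arc 1 ∪ R.arc 3).Nonempty := ⟨_, Or.inr (R.pt_mem_arc_self 3)⟩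
    obtain ⟨r₀, hr₀, hfar₀⟩ := exists_pos_le_infDist hK₀ (((R.isClosed_arc 1).union (R.isClosed_arc 2)).union (R.isClosed_arc 3))
      hF₀ne (disjoint_union_right.2 ⟨disjoint_union_right.2 ⟨disjoint_collarPiece_arc R S.T hh1 (by decide) hsub₀,
        disjoint_collarPiece_arc R S.T hh1 (by decide) hsub₀⟩, disjoint_collarPiece_arc R S.T hh1 (by decide) hsub₀⟩)
    obtain ⟨r₂, hr₂, hfar₂⟩ := exists_pos_le_infDist hK₂ (((R.isClosed_arc 0).union (R.isClosed_arc 1)).union (R.isClosed_arc 3))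
      hF₂ne (disjoint_union_right.2 ⟨disjoint_union_right.2 ⟨disjoint_collarPiece_arc R S.T hh1 (by decide) hsub₂,
        disjoint_collarPiece_arc R S.T hh1 (by decide) hsub₂⟩, disjoint_collarPiece_arc R S.T hh1 (by decide) hsub₂⟩)
    have hρc := (isClosed_closure.notMem_iff_infDist_pos (R.nonempty.mono subset_closure)).1 hpcΩ
    have hρb := (isClosed_closure.notMem_iff_infDist_pos (R.nonempty.mono subset_closure)).1 hpbΩ
    set r := min (min r₁ (min r₀ r₂)) (min (infDist (L t_c) (closure R.carrier)) (infDist (L (t_b + 1)) (closure R.carrier))) with hr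
    have hr1 : r ≤ r₁ := (min_le_left _ _).trans (min_le_left _ _)
    have hr0 : r ≤ r₀ := (min_le_left _ _).trans ((min_le_right _ _).trans (min_le_left _ _))
    have hr2 : r ≤ r₂ := (min_le_left _ _).trans ((min_le_right _ _).trans (min_le_right _ _))
    have hrc : r ≤ infDist (L t_c) (closure R.carrier) := (min_le_right _ _).trans (min_le_left _ _)
    have hrb : r ≤ infDist (L (t_b + 1)) (closure R.carrier) := (min_le_right _ _).trans (min_le_right _ _)
    have hA : ∀ (A B : Set ℂ) (z : ℂ), A.Nonempty → A ⊆ B → infDist z B ≤ infDist z A := fun A B z hA hAB =>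
      infDist_le_infDist_of_subset hAB hA
    refine ⟨C₀, C₂, r, lt_min (lt_min hr₁ (lt_min hr₀ hr₂)) (lt_min hρc hρb), fun z hz => hsplit z hz.1 hz.2,
      fun z hz w hw => hr1.trans (hsep z hz w hw), fun z hz => ?_, fun z hz => ?_, ?_, ?_⟩
    · have h := hr0.trans (hfar₀ z hz)
      exact ⟨h.trans (hA _ _ z ⟨_, R.pt_mem_arc_self 1⟩ (subset_union_left.trans subset_union_left)),
        h.trans (hA _ _ z ⟨_, R.pt_mem_arc_self 2⟩ (subset_union_right.trans subset_union_left)),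
        h.trans (hA _ _ z ⟨_, R.pt_mem_arc_self 3⟩ subset_union_right)⟩
    · have h := hr2.trans (hfar₂ z hz)
      exact ⟨h.trans (hA _ _ z ⟨_, R.pt_mem_arc_self 0⟩ (subset_union_left.trans subset_union_left)),
        h.trans (hA _ _ z ⟨_, R.pt_mem_arc_self 1⟩ (subset_union_right.trans subset_union_left)),
        h.trans (hA _ _ z ⟨_, R.pt_mem_arc_self 3⟩ subset_union_right)⟩
    · rintro z ⟨hzb, hzD⟩
      rw [hp0, mem_ball] at hzb
      have hzΩ : z ∉ closure R.carrier := fun hcl => by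
        have := infDist_le_dist_of_mem (x := L t_c) hcl
        rw [dist_comm] at this; linarith
      rcases hsplit z hzD (fun h => hzΩ (subset_closure h)) with h | h
      · have := hsep z h _ hpc; linarith
      · exact h
    · rintro z ⟨hzb, hzD⟩
      rw [hp1, mem_ball] at hzb
      have hzΩ : z ∉ closure R.carrier := fun hcl => by
        have := infDist_le_dist_of_mem (x := L (t_b + 1)) hcl
        rw [dist_comm] at this; linarith
      rcases hsplit z hzD (fun h => hzΩ (subset_closure h)) with h | h
      · exact h
      · have := hsep _ hpb z h; rw [dist_comm] at this; linarith

include htc htb in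
/-- **Closeness of the lower rectangle to `R` relabelled `(c, d, a, b)`**: the re-based loop is uniformly
`ε`-close and the marks are `ε`-close, after the shift `c = t_c`, to `(m₂, m₃, m₀ + 1, m₁ + 1)`. -/
theorem lower_close : (∀ s : ℝ, dist ((S.lowerRect htc htb).boundary s) (R.boundary (s + t_c)) ≤ ε) ∧
    |(S.lowerRect htc htb).mark 0 + t_c - R.mark 2| ≤ ε ∧ |(S.lowerRect htc htb).mark 1 + t_c - R.mark 3| ≤ ε ∧
    |(S.lowerRect htc htb).mark 2 + t_c - (R.mark 0 + 1)| ≤ ε ∧ |(S.lowerRect htc htb).mark 3 + t_c - (R.mark 1 + 1)| ≤ ε := by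
  have hδ := S.δ_pos; have hδε := S.δ_le
  obtain ⟨e0, e1, e2, e3⟩ := S.lowerM_τ htc htb
  refine ⟨fun s => ?_, ?_, ?_, ?_, ?_⟩
  · rw [boundary_lowerRect, profileLoop]
    exact (S.dist_lt_ε _ (S.lowerP.lower (s + t_c)) (S.lowerP.upper (s + t_c))).le
  · rw [mark_lowerRect_add, e0, abs_le]; constructor <;> linarith [htc.1, htc.2]
  · rw [mark_lowerRect_add, e1, abs_le]; constructor <;> linarith
  · rw [mark_lowerRect_add, e2, abs_le]; constructor <;> linarith
  · rw [mark_lowerRect_add, e3, abs_le]; constructor <;> linarith [htb.1, htb.2]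

end CollarSetup

/-- **Main statement of this file** (registered helper stub, arrow style): the lower comparison rectangle
has the lower readout geometry and is `ε`-close to `R` relabelled `(c, d, a, b)`. -/
theorem lowerRect_spec : ∀ {R : ConformalRectangle} {ε : ℝ} (S : CollarSetup R ε) {t_c t_b : ℝ} (htc : t_c ∈ Icc (R.mark 2 + 2 * S.δ) (R.mark 2 + 3 * S.δ)) (htb : t_b ∈ Icc (R.mark 1 - 3 * S.δ) (R.mark 1 - 2 * S.δ)), LowerCollarGeom R ((S.lowerRect htc htb).chord 0 3 (by decide)) ((S.lowerRect htc htb).arc 1) ∧ (∀ s : ℝ, dist ((S.lowerRect htc htb).boundary s) (R.boundary (s + t_c)) ≤ ε) ∧ |(S.lowerRect htc htb).mark 0 + t_c - R.mark 2| ≤ ε ∧ |(S.lowerRect htc htb).mark 1 + t_c - R.mark 3| ≤ ε ∧ |(S.lowerRect htc htb).mark 2 + t_c - (R.mark 0 + 1)| ≤ ε ∧ |(S.lowerRect htc htb).mark 3 + t_c - (R.mark 1 + 1)| ≤ ε :=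
  fun S _ _ htc htb => ⟨S.lowerCollarGeom htc htb, S.lower_close htc htb⟩

end Summit.CriticalPhenomena.CardyFormulaZ2.Cruxes.SLESixFamiliesGiveCardy.CollarTouchSandwich

end
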